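import Summits.ResolutionOfSingularities.ResolutionOfSingularities.Theorems.HilbertSamuelEliminationSigmaMaxModificationsCorridor3WLadderChainTowerCentred
import Summits.ResolutionOfSingularities.ResolutionOfSingularities.Theorems.HilbertSamuelEliminationSigmaMaxModificationsCorridor3WLadderIsoLowSocket
import Summits.ResolutionOfSingularities.ResolutionOfSingularities.Theorems.HilbertSamuelEliminationSigmaMaxModificationsCorridor3WLadderMovingTwoBlownUpCentre
import Summits.ResolutionOfSingularities.ResolutionOfSingularities.Theorems.HilbertSamuelEliminationSigmaMaxModificationsCorridor3WMono
import HarnessLib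

/-!
# [OURS · L1 W4.2] β-PORT, PART 1: `e ≤ 1` PROPAGATES ALONG A CHAIN in the (F1♯) form (`ē ≤ 2`, any prime, any regime)
# — the e-propagation step of the characteristic-2 residue `IsoE1BridgeFreeM p` of `stub_Wlow3M_two`
# (crux chain w42, line `w_ladder`; `--supports stmt-…-19249`, helper)

OURS (cell res-hironaka, slot W4.2, seat res-L1-w42-stub-2 gen 3); NOT statements of H. Hironaka's manuscript [Hironaka2017]
nor of [CossartJannsenSaito2020]. AI-drafted, weaker than expert review. Sorry-free PROOF file (no new definition). This is
stub-2's `…Corridor3WLadderIsoLowSocket` e-propagation (`dirDim_le_one_of_genuineStep`, `dirDim_le_one_of_chain`) with the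
(F1) regime `QCharRegime p` + CJS Thm. 3.14 (`CossartJannsenSaito2020_thm_3_14`, `Thm314_point_locus`) REPLACED by `ē ≤ 2`
+ the (F1♯) shadows `Theorem314_geomDir` / `Thm314_point_locus_geomDir` (stub-3's OURS carriers, `…MovingTwoDefs`; (F1♯)
`GeomDirHypothesis` is automatic at `ē ≤ 2`, `geomDirHypothesis_of_geomDirDim_le_two`), per res-L1-w42-plan-1 RULINGS
v3.11 (3)/(15)(c). Conditional on the binders BY NAME: `Theorem314_geomDir`, `Thm314_point_locus_geomDir`, `ProjDir_line`
(p503241), `CossartJannsenSaito2020_thm_3_10_4` (p499783).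

* `Moving.geomDirDim_eq_of_stalkIso` — `ē` depends only on the local ring.
* `Moving.geomDirDim_chain_le` — **`ē` does not increase along a chain of canonical near steps from a maximal origin**
  (`ν ≠ Φ^{(3)}`; lead-1's `geomDirDim_le_of_canonicalNearStep_of_stateGood`, CJS Thm. 3.10 (4)).
* `Moving.dirDim_le_one_of_genuineStep_geomDir` — **at a genuine step from a stage with `e = 1` and `ē ≤ 2` the next marked
  point has `e ≤ 1`**: the centre is `𝔪` (stub-3's `stalkIdeal_centre_eq_maximalIdeal_of_reaches_geomDir`), read on the local
  point blow-up over `Spec 𝒪` (stub-2's `…LocalPointBlowup`), the near lift lies on `ℙ(Dir)` (`Thm314_point_locus_geomDir`),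
  a single rational point (`ProjDir_line`), so `e` cannot rise (lead-1's `dirDim_le_of_hsFun_eq_of_isIso_residueFieldMap`,
  Thm. 3.10 (4)).
* `Moving.dirDim_le_one_of_chain_geomDir` — **`e ≤ 1` all along a chain from a stage with `e ≤ 1`, `ē ≤ 2`.**

## References

* V. Cossart, U. Jannsen, S. Saito, LNM 2270 (2020): Thm. 2.14, Thm. 3.10 (4), Thm. 3.14, p. 107. [CossartJannsenSaito2020]
-/

noncomputable section

-- namespace `…Corridor3.Moving` re-enters `…Corridor3` (module convention of the Moving files)
set_option linter.dupNamespace false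

open CategoryTheory CategoryTheory.Limits AlgebraicGeometry TopologicalSpace IsLocalRing
open Literature.AlgebraicGeometry.Resolution Literature.RingTheory.HilbertSamuel
open Scheme.IdealSheafData

universe u

open Summit.ResolutionOfSingularities.ResolutionOfSingularities.Theorems.CampaignW42
open Literature.AlgebraicGeometry.CossartJannsenSaito2020
open Summit.ResolutionOfSingularities.ResolutionOfSingularities.Theorems.SigmaMaxModificationsCorridor3

namespace Summit.ResolutionOfSingularities.ResolutionOfSingularities.Theorems.SigmaMaxModificationsCorridor3.Moving

variable {R : ∀ S : Scheme.{u}, CentreSeq S → Prop} {ν : ℕ → ℕ}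

/-! ## `ē` is a stalk invariant and does not increase along a chain -/

/-- `ē` depends only on the local ring (CJS Def. 2.21 / 2.26). [cite: CossartJannsenSaito2020, Def. 2.26] -/
theorem geomDirDim_eq_of_stalkIso {X Y : Scheme.{u}} [IsLocallyNoetherian X] [IsLocallyNoetherian Y] {x : X} {y : Y}
    (e : X.presheaf.stalk x ≅ Y.presheaf.stalk y) : Scheme.geomDirDim X x = Scheme.geomDirDim Y y :=
  (geomDirDim_eq_of_ringEquiv e.commRingCatIsoToRingEquiv).symm

/-- **`ē` does not increase along a chain of canonical near steps from a maximal origin** (any prime, any regime,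
`ν ≠ Φ^{(3)}`): waiting steps keep the local ring, genuine steps are CJS Thm. 3.10 (4) at the closed near point (lead-1's
`geomDirDim_le_of_canonicalNearStep_of_stateGood`, good states from s42's `stateGood_init_general`).
[cite: CossartJannsenSaito2020, Thm. 3.10 (4)] -/
theorem geomDirDim_chain_le (h3104 : CossartJannsenSaito2020_thm_3_10_4.{u}) (hRa : OracleAdmissible R) {p : ℕ}
    {X : Scheme.{u}} [IsLocallyNoetherian X] {x : X} (hX : IsMaximalOrigin p 3 ν X x) (hν : ν ≠ iterPSum 3 Phi)
    {c : ℕ → MarkedStage.{u}} (h0 : Reaches R 3 ν (MarkedStage.init X x) (c 0))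
    (hstep : ∀ n, CanonicalNearStep R 3 ν (c n) (c (n + 1))) (n : ℕ) : (c n).geomDirDim ≤ (c 0).geomDirDim := by
  obtain ⟨k, _, _, f, -, hft, hqc⟩ := hX.exists_structure
  haveI := hft
  haveI := hqc
  haveI := hX.isReduced
  induction n with
  | zero => exact le_rfl
  | succ n ih =>
    have hgood : StateGood k R 3 ν (c n).W (c n).L (c n).P :=
      stateGood_of_reaches (stateGood_init_general hRa f hX.dim_le hX.maximal hν) (reaches_chain h0 hstep n)
    have hmem : (c n).pt ∈ Scheme.hsStratum (c n).W 3 ν :=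
      pt_mem_hsStratum_of_reaches hX.mem_stratum (reaches_chain h0 hstep n)
    exact (Helpers.geomDirDim_le_of_canonicalNearStep_of_stateGood h3104 hgood hmem (hstep n)).trans ih

/-! ## `e ≤ 1` propagates through a genuine step, (F1♯) form -/

/-- **At a GENUINE step from a stage with `e = 1` and `ē ≤ 2`, the next marked point has `e ≤ 1`** (any maximal origin,
`ν ≠ Φ^{(3)}`; modulo the binders). The centre is `𝔪_{x_n}` ((F1♯) form of Thm. 3.14, `ē ≤ 2`); on the local blow-up
`P = Bℓ_𝔪 → Spec 𝒪_{X_n,x_n}` the lift `y` of `x_{n+1}` is near, hence on `ℙ(Dir(𝒪))` (`Thm314_point_locus_geomDir`, (F1♯)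
at the closed point from `ē ≤ 2`), a line's worth: the single `κ`-rational point (`ProjDir_line`), so
`e_y(P) ≤ e_𝔪(Spec 𝒪) = 1` (`dirDim_le_of_hsFun_eq_of_isIso_residueFieldMap`, Thm. 3.10 (4)); and `𝒪_{P,y} ≅ 𝒪_{X_{n+1},x_{n+1}}`.
[cite: CossartJannsenSaito2020, Thm. 2.14, Thm. 3.14, Thm. 3.10 (4), p. 107] -/
theorem dirDim_le_one_of_genuineStep_geomDir (hF : Theorem314_geomDir.{u})
    (h3104 : CossartJannsenSaito2020_thm_3_10_4.{u}) (h214 : Thm314_point_locus_geomDir.{u}) (hline : ProjDir_line.{u})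
    (hRf : OracleFunctional R) (hRa : OracleAdmissible R) {p : ℕ} {X : Scheme.{u}} [IsLocallyNoetherian X] {x : X}
    (hX : IsMaximalOrigin p 3 ν X x) (hν : ν ≠ iterPSum 3 Phi)
    {s s' : MarkedStage.{u}} (hreach : Reaches R 3 ν (MarkedStage.init X x) s) (hst : CanonicalNearStep R 3 ν s s')
    (hb : s.IsBlownUp R 3 ν) (he : dirDim s = 1) (hē : s.geomDirDim ≤ 2) : dirDim s' ≤ 1 := by
  haveI : IsLocallyNoetherian s.W := s.ln
  obtain ⟨k, _, _, f, -, hft, hqc⟩ := hX.exists_structure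
  haveI := hft
  haveI := hqc
  haveI := hX.isReduced
  have hgood : StateGood k R 3 ν s.W s.L s.P :=
    stateGood_of_reaches (stateGood_init_general hRa f hX.dim_le hX.maximal hν) hreach
  have hpt : s.pt ∈ Scheme.hsStratum s.W 3 ν := pt_mem_hsStratum_of_reaches hX.mem_stratum hreach
  have hpt' : s'.pt ∈ Scheme.hsStratum s'.W 3 ν := hst.pt_mem_hsStratum
  obtain ⟨C, x', hC, hmax, hπ, -, hiso⟩ := exists_genuineStep_of_pointCentre hRf hRa hX hν hreach hst hb
    (fun C P' hcs hmem => stalkIdeal_centre_eq_maximalIdeal_of_reaches_geomDir hF hRf hRa hX hν hreach hst he.le hē hcs hmem)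
  -- read on the blow-up `P → Spec 𝒪_{X_n,x_n}` of the closed point
  haveI : IsLocallyNoetherian (blowup C) := CentreSeq.isLocallyNoetherian_blowup C
  haveI := isLocallyNoetherian_pullback_fromSpecStalk (blowup.isBlowup C) s.pt
  have hc : (s.W.fromSpecStalk s.pt).base (closedPoint (s.W.presheaf.stalk s.pt)) = s.pt := Scheme.fromSpecStalk_closedPoint
  have hP := isBlowup_pullback_snd_fromSpecStalk_singleton (blowup.isBlowup C) hC hmax hc
  obtain ⟨y, hy, hyc, hyiso⟩ := exists_lift_pullback_fromSpecStalk (blowup.π C) s.pt hπ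
  have hyc' : (pullback.snd (blowup.π C) (s.W.fromSpecStalk s.pt)).base y = closedPoint (s.W.presheaf.stalk s.pt) :=
    eq_closedPoint_of_fromSpecStalk_eq hyc
  -- the setting on `Spec 𝒪`
  have hexc : Scheme.IsExcellent (Spec (s.W.presheaf.stalk s.pt)) :=
    Scheme.isExcellent_Spec_of_isExcellentRing _ (isExcellentRing_stalk_of_isExcellent hgood.isExcellent s.pt)
  have hdimO : topologicalKrullDim ↥(Spec (s.W.presheaf.stalk s.pt)) ≤ ((3 : ℕ) : WithBot ℕ∞) :=
    ((s.W.fromSpecStalk s.pt).isEmbedding.isInducing.topologicalKrullDim_le).trans hgood.dim_le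
  have heO : Scheme.dirDim (Spec (s.W.presheaf.stalk s.pt)) (closedPoint (s.W.presheaf.stalk s.pt)) = 1 := by
    rw [Scheme.dirDim_fromSpecStalk_closedPoint]; exact he
  have hpermO : IdealSheafData.IsPermissible
      (vanishingIdeal (⟨{(closedPoint (s.W.presheaf.stalk s.pt) : ↥(Spec (s.W.presheaf.stalk s.pt)))},
        isClosed_singleton_of_fromSpecStalk_eq hc⟩ : Closeds ↥(Spec (s.W.presheaf.stalk s.pt)))) :=
    isPermissible_singleton_of_one_le_dirDim _ heO.symm.le
  have hgeoO : GeomDirHypothesis (Spec (s.W.presheaf.stalk s.pt)) (closedPoint (s.W.presheaf.stalk s.pt)) := by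
    apply geomDirHypothesis_of_geomDirDim_le_two
    rw [Scheme.geomDirDim_fromSpecStalk_closedPoint]
    have h := hē
    rw [MarkedStage.geomDirDim] at h
    exact h
  -- the lift is near, hence on `ℙ(Dir)`, hence rational
  haveI : IsLocallyNoetherian s'.W := s'.ln
  have hnearW : Scheme.hsFun (blowup C) 3 x' = Scheme.hsFun s.W 3 s.pt := by
    obtain ⟨e⟩ := hiso
    rw [hsFun_eq_of_stalkIso e, Scheme.mem_hsStratum_iff.mp hpt', Scheme.mem_hsStratum_iff.mp hpt]
  have hnear := hsFun_lift_eq_hsFun_closedPoint (blowup.π C) s.pt 3 hy hnearW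
  have hmemsupp : (pullback.snd (blowup.π C) (s.W.fromSpecStalk s.pt)).base y ∈
      ((vanishingIdeal (⟨{(closedPoint (s.W.presheaf.stalk s.pt) : ↥(Spec (s.W.presheaf.stalk s.pt)))},
        isClosed_singleton_of_fromSpecStalk_eq hc⟩ : Closeds ↥(Spec (s.W.presheaf.stalk s.pt)))).support : Set _) := by
    rw [Scheme.IdealSheafData.coe_support_vanishingIdeal]; exact hyc'
  have hon : IsOnProjDirectrix (pullback.snd (blowup.π C) (s.W.fromSpecStalk s.pt)) y :=
    h214 _ _ _ _ _ 3 y hexc hpermO hP hdimO hyc' hgeoO (by rw [hnear])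
  haveI : IsIso ((pullback.snd (blowup.π C) (s.W.fromSpecStalk s.pt)).residueFieldMap y) :=
    (hline _ _ _ _ _ hP heO).2 y ((mem_projDirectrixFibre _ _ _).mpr ⟨hyc', hon⟩)
  have hle := dirDim_le_of_hsFun_eq_of_isIso_residueFieldMap h3104 hexc hpermO hP hdimO hmemsupp (by rw [hnear, hyc'])
  -- back to the chain
  rw [hyc', heO, dirDim_lift_eq, hy] at hle
  obtain ⟨e⟩ := hiso
  show Scheme.dirDim s'.W s'.pt ≤ 1
  rw [← dirDim_eq_of_stalkIso e]
  exact hle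

/-- **`e ≤ 1` PROPAGATES along a chain from a stage with `e ≤ 1` and `ē ≤ 2`** (any maximal origin, `ν ≠ Φ^{(3)}`; modulo
the binders): `ē ≤ 2` persists (`geomDirDim_chain_le`); waiting steps keep `e`; a genuine step at `e = 0` is impossible
(stub-3's `false_of_isBlownUp_of_dirDim_eq_zero_geomDir`); at `e = 1` the previous theorem.
[cite: CossartJannsenSaito2020, Thm. 3.14, Thm. 3.10 (4)] -/
theorem dirDim_le_one_of_chain_geomDir (hF : Theorem314_geomDir.{u})
    (h3104 : CossartJannsenSaito2020_thm_3_10_4.{u}) (h214 : Thm314_point_locus_geomDir.{u}) (hline : ProjDir_line.{u})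
    (hRf : OracleFunctional R) (hRa : OracleAdmissible R) {p : ℕ} {X : Scheme.{u}} [IsLocallyNoetherian X] {x : X}
    (hX : IsMaximalOrigin p 3 ν X x) (hν : ν ≠ iterPSum 3 Phi)
    {c : ℕ → MarkedStage.{u}} (h0 : Reaches R 3 ν (MarkedStage.init X x) (c 0))
    (hstep : ∀ n, CanonicalNearStep R 3 ν (c n) (c (n + 1))) (he : dirDim (c 0) ≤ 1) (hē : (c 0).geomDirDim ≤ 2) (n : ℕ) :
    dirDim (c n) ≤ 1 := by
  have hG : ∀ n, (c n).geomDirDim ≤ 2 := fun n => (geomDirDim_chain_le h3104 hRa hX hν h0 hstep n).trans hē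
  induction n with
  | zero => exact he
  | succ n ih =>
    by_cases hb : (c n).IsBlownUp R 3 ν
    · rcases Nat.lt_or_ge (dirDim (c n)) 1 with h0' | h1
      · exact (false_of_isBlownUp_of_dirDim_eq_zero_geomDir hF hRf hRa hX (reaches_chain h0 hstep n) hb (hstep n)
          (by omega) (hG n)).elim
      · exact dirDim_le_one_of_genuineStep_geomDir hF h3104 h214 hline hRf hRa hX hν (reaches_chain h0 hstep n) (hstep n)
          hb (le_antisymm ih h1) (hG n)
    · rw [dirDim_eq_of_step_of_not_isBlownUp (hstep n) hb]; exact ih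

end Summit.ResolutionOfSingularities.ResolutionOfSingularities.Theorems.SigmaMaxModificationsCorridor3.Moving

end
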